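import Mathlib.Data.Real.Basic
import Mathlib.Data.Matrix.Basic
import Mathlib.Tactic
import Literature.Geometry.Lorentzian.Hintz2026.ExteriorNormalOperator
import HarnessLib

/-!
# Hintz 2026, §11.1 (`SsDAdm`): the forward-solution interface with [AF] — the parameter dictionary of
# Cor `CorDAdm` / Thm `ThmDAdmReg` / Thm `ThmAdm` versus [AF] Def 5.18 / Thm 11.1 / Def 5.13 (bookkeeping only)

CITATION HEADER (lean-in-tree rule 2026-08-18).  P. Hintz, *Nonlinear stability of subextremal Kerr black
holes*, arXiv:2606.28253 **v2** (2026-08-03), bib key `Hintz2026` — an UNREFEREED CLAIM under adjudication in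
this library; TeX line numbers `H l.N` refer to the v2 source `kerr-stab-r.tex`.  Its companion P. Hintz,
*(Non-)Linear waves on asymptotically flat spacetimes. II*, arXiv:2606.28008 **v1**, bib key `Hintz2026WavesII`
("[AF]" in Hintz 2026) is likewise UNREFEREED; `AF l.N` refers to its e-print `nonstat2.tex`, and "(5.23)",
"Thm 11.1" etc. are the numbers printed in the public v1 PDF.  This module is the audit cell `pub-kerr`'s
HINTZ-PLAN item P26 (4) / P29: the place where Hintz 2026 imports the linear main theorem of [AF]
("The key consequence of Corollary `CorDAdm` is that the main result of [AF] becomes applicable … We state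
[AF, Theorem 11.1], in the form using unweighted b-densities as in [AF, (11.5)–(11.6a)]", H l.11024).
Nothing here is analysis: we record, as exact rational / real / natural-number arithmetic and as finite matrix
identities, the PRINTED parameter windows on both sides of the interface and prove that Hintz's printed
hypotheses land inside [AF]'s printed hypotheses.  What is proved:

* §1 `densityShift_eq_half`, `hypScri_iff`, `hypPlus_iff`, `kOrder_muB` — the density dictionary [AF]
  (11.4)–(11.5) (AF l.10845–10867): passing from the Minkowskian density `|dt dx|` to the b-density
  `μ_b = ρ_𝒥³ρ₊⁴ρ_𝒦 |dt dx|` shifts the three weights by `(3/2, 2, 1/2)` = half the exponents `(3,4,1)`, which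
  turns [AF] Thm 11.1's hypotheses `α_𝒥 < −½ + S̲`, `α₊ < α_𝒥 − ½` into the printed `β_𝒥 < 1 + S̲`,
  `β₊ < β_𝒥`, and the `𝒦⁺`-orders `(−ℵ; 0)` of (11.3) into `(−ℵ+½; ½)` of (11.6a); `srcA27` records that the
  `𝒦⁺`-orders `(−2; 0, 0)` printed in Hintz's tame estimate (EqDAdmRegTame) (H l.11046–11048) are the (11.3)
  values, NOT the (11.6a) values `(−3/2; ½, ½)` printed two lines earlier in (EqDAdmRegu)/(EqDAdmRegf) — the
  cell's DIVERGENCE SRC-A27 (a ½-shift slip; load nil).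
* §2 `RegParams` = the printed hypotheses of Hintz Thm `ThmDAdmReg` (H l.11028: `β₊ ∈ (½, ½+ε_ind)`,
  `β_𝒥 ∈ (β₊, 1)`, `δ > β₊ − ½`); with [AF]'s identification "sf-weight `β₊ − 2`" (AF l.10858) they give
  EXACTLY Hintz Thm `ThmAdm`'s hypothesis `α_sf + 3/2 ∈ (0, ε_ind)`, `δ > α_sf + 3/2` (H l.9789–9791)
  (`thmAdm_window`, `thmAdm_loss`), [AF] Thm 11.1's `β_𝒥 < 1 + S̲` for every `S̲ ≥ 0` — Hintz prints
  `min spec S = 0` (H l.7359, l.8225) — and `β₊ < β_𝒥` (`af111_scri`, `af111_plus`), and [AF] Thm 14.2's toy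
  range `α_sf ∈ (−3/2, −½)` (`af142_range`, needs `ε_ind ≤ 1`); `iotaOrder_lt_half` /
  `exists_params_near` are the sentence "Theorem `ThmDAdmReg` gives `u ∈ H_b^{∞,(1−ε, ½−ε, −3/2)}` for all
  `ε > 0`" (H l.11363); `exists_delta_lt_one` is "δ > α_sf + 3/2 ∈ (0, ε_ind) can be taken to be `< ε_ind` (and
  thus `< 1`)" (H l.11007) given `ε_ind ≤ ½` (H (EqWEIndEps), l.7566: `ε_ind ≤ d(Re λ, ℤ)`).
* §3 `corDAdmBox_iff` — the weight triple printed in Cor `CorDAdm` (H l.11012–11014: `ℓ_𝒥 < min(2γ^Υ, ½)`,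
  `ℓ₊ ∈ (δ, 1)`, `ℓ_𝒦 ∈ (2, 2+ε_𝒦]`) is EXACTLY the intersection of what Lemma `LemmaDAdmMet` supplies
  ((EqDAdmMetells), H l.10868–10871) with what [AF] Def 5.18 demands ((5.23) `EqSDWAdmWeights`, AF l.5607–5611,
  at `ℵ = 2`); it lies inside [AF] Def 5.15's ranges (`corDAdmBox_afMetricRanges`, AF l.5520) and inside the
  weaker box of Remark `RmkDAdmRegh` (H l.11017); it is inhabited iff `γ^Υ > 0`, `δ < 1`, `ε_𝒦 > 0`
  (`corDAdmBox_nonempty_iff`) — which is why H l.11007 insists on `δ < 1`.  The ℕ-valued regularity indices of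
  the proof of Cor `CorDAdm` (H l.11021): class `(0; k−5)` = `k −` (curvature loss 2 of Prop `PropDAdmLin` +
  Sobolev-embedding loss 3 of Lemma `LemmaDAdmMet` / [AF] Lemma 3.22), the `p₀, p̃₁ ∈ 𝒞^{k−4}` margin, and the
  `d`-bookkeeping "up to increasing `d` further by a constant amount" (H l.11052): `d_bookkeeping`.
* §4 `exA_eq_submatrix`, `exB_eq_submatrix`, `exA_lower`, `exB_strictLower`, `exA_diag` — [AF] Def 5.18(3)
  (`ItSDWAdmSplit`, AF l.5626: "a bundle splitting in which `p₁` is lower triangular, with the diagonal entries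
  having real spectrum; and `p₀` is strictly lower triangular") as Hintz asserts it (H l.11021: "`p₁ … = A_h`,
  and thus the required bundle splitting … is given by (EqExOpLinSplit)"): the printed 7×7 matrices `A_h`, `B_h`
  of (EqExOpLinAB) (H l.4772–4796, splitting (EqExOpLinSplit) l.4764) ARE lower / strictly lower triangular with
  the scalar diagonal `(2(1−v^𝓒)γ^𝓒, (1−v^𝓒)γ^𝓒, (1−e^𝓒)(1−v^𝓒)γ^𝓒, (1−e^Υ)γ^Υ, γ^Υ, 0, 2γ^Υ)`, and they are
  the permutation-conjugates (`toFine` = (EqExOpLinSplit) ↦ (EqKNullS2TFine), H l.3923) of the matrices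
  (EqExOpLinAhBh) (H l.5005–5025) transcribed in `ExteriorNormalOperator.hintzA` — the sentence "Upon passing to
  the splitting (EqExOpLinSplit), one obtains the expressions (EqExOpLinAB)" (H l.5027) made literal.
* §5 `thrOut` — the right-hand side of [AF] Def 5.11(5) (`EqSSOrderAdmOut`, AF l.5418–5419:
  `s + α_sf < ½(−1+ϑ_out) + α_𝒦 − η`): [AF]'s own instance (EqA2AdmThr) (AF l.12487–12490, `α_𝒦 = −1`,
  `η = 0`, `ϑ = 0`) is `−3/2` (`thrOut_af142`), the spectral-side (9.7) `EqSpBThrOut` is `thrOut (2S̲) 0 0`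
  (`thrOut_spB`); at Hintz's (EqAdm) parameters (H l.9817–9820: weights `α_sf, −2`, margin `1`; `ϑ_out = 0` by
  H l.9834) the cited display evaluates to `−7/2` (`thrOut_hintzEqAdm`), whereas Remark `RmkAdmUpper` (H l.9834)
  prints "`s + α_sf < −½ − 1`" `= thrOut 0 0 1` — the two agree iff `α_𝒦 = 0` (`thrOut_printed_iff`): the
  cell's DIVERGENCE SRC-A28 (an explanatory remark; the theorem `ThmAdm` quantifies over [AF]'s class by
  reference; classification and load in HINTZ-PLAN P29).
* §7 `lemma146_cs_exponent`, `lemma146_window`, `lemma146_integrability`, `srcA31` — Hintz Lemma `LemmaAdmPfInt`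
  (H l.10640–10660, "the following variant of [AF, Lemma 14.6]") re-proves [AF] Lemma 14.6 (AF l.12595–12612); the
  Cauchy–Schwarz / Fubini exponent bookkeeping of the displayed chain: splitting `s^{ℓ−1} = s^α · s^{ℓ−1−α}` gives the
  squared weights `2α` and `2ℓ−2−2α` ([AF] l.12606), the window `α ∈ (−½, ℓ−1)` is inhabited iff `ℓ > ½` (the
  lemma's hypothesis), and the total `s`-power after `∫_s^∞ t^{−2ℓ+2α+1}dt ≂ s^{−2ℓ+2α+2}` is `0` with [AF]'s
  exponent but `1` with the exponent "`2ℓ−2α−1`" printed at H l.10657–10658 — the cell's DIVERGENCE SRC-A31 (a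
  transcription slip in an intermediate line; the conclusion `≲ ‖f₀‖²` needs and has [AF]'s exponent; nil).
* `no_root_near_integer` (§2) — (EqWEIndEps) ("`d(Re λ, ℤ) ≥ ε_ind` for all non-integer indicial roots", H l.7566)
  with `ε_ind ≤ 1` keeps every real part of an indicial root out of `(n − ε_ind, n)` for every integer `n`: the
  sentence "uses that such `α` [`∈ (−1−ε_ind, −1)`] are not the real part of any indicial root of `L̂_b(0)`" (H l.8066,
  the application of [AF] Thm 9.36 in Step 0 of the proof of Prop `PropWE0s2`), `n = −1`.
* §6 `prop1318_iff` and three printed instances — [AF] Prop 13.18 (`PropDResLo`, AF l.12099–12115) needs, for an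
  input of orders `(β_scf+1, β_tf+2, β_zf)`, `β_tf − β_zf` in the indicial gap; in terms of the input's tf- and
  zf-orders this is "relative order `∈ (β⁻+2, β⁺+2)`", the form Hintz uses (H l.12296, l.12549, l.13883); the
  instances `inst_H11422`, `inst_H12549`, `inst_H13883` check the printed relative orders land in `(2, 2+ε_ind)`
  from the printed ranges (Prop `PropD4Par`: `α_𝒦 ∈ (2, 2+ε_𝒦)`; (EqDMetBasicEllEps), H l.10796:
  `0 < ε_𝒦 < ε₊ < min(ε_ind, ε_𝒥) < 1`).
Nothing here asserts that any estimate holds, that `A_h`, `B_h` ARE the normal-operator data of `L_{g,g⁰}`, or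
that [AF] Thm 11.1 is true; no named facts (D-0026).  VERSION 2 (same seat, same day): §7 and `no_root_near_integer`
added (HINTZ-PLAN P30); every v1 declaration unchanged.  Companions: `Hintz2026/ExteriorNormalOperator.lean`
(the (EqExOpLinAhBh) transcription, imported), `Hintz2026/NashMoserInterface.lean`, `Hintz2026/DataClasses.lean`.

## References
* P. Hintz, arXiv:2606.28253v2 (2026): (EqKNullS2TFine) l.3923; Prop `PropExOpLin` (EqExOpLinSplit) l.4764,
  (EqExOpLinAB) l.4772–4796, (EqExOpLinAhBh) l.5005–5027; (EqWEIndEps) l.7566; Thm `ThmAdm` l.9789–9792,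
  (EqAdm) l.9817–9830, Remark `RmkAdmUpper` l.9832–9835; (EqDMetBasicEllEps) l.10796; Lemma `LemmaDAdmMet`
  (EqDAdmMetells) l.10862–10873; §11.1.3 l.11007; Cor `CorDAdm` l.11010–11014, Remark `RmkDAdmRegh` l.11017,
  proof l.11020–11022; Thm `ThmDAdmReg` l.11026–11050, l.11052; l.11363; Prop `PropD4Par` l.12380; l.11422,
  l.12296, l.12549, l.13883; l.8066; Lemma `LemmaAdmPfInt` l.10640–10660. [Hintz2026]
* P. Hintz, arXiv:2606.28008v1 (2026): Lemma 3.22; Def 5.11 (5.21) AF l.5411–5419; Lemma 5.12 AF l.5436–5441;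
  Def 5.13 AF l.5466–5485; Def 5.15 AF l.5519–5527; Def 5.18 (5.23)–(5.25) AF l.5605–5640; (9.7) AF l.7974;
  Thm 11.1 (11.2)–(11.6a) AF l.10822–10867; Prop 13.18 AF l.12099–12115; (14.3) `EqA2AdmThr` AF l.12484–12490;
  Thm 14.2 AF l.12480; Lemma 14.6 AF l.12595-12612. [Hintz2026WavesII]
-/

namespace Literature.Geometry.Lorentzian

namespace Hintz2026.ForwardSolutionDictionary

/-! ## §1  The density dictionary [AF] (11.4)–(11.5) and the slip SRC-A27 -/

/-- Exponents of `(ρ_𝒥, ρ₊, ρ_𝒦)` in `|dt dx| = ρ_𝒥^{-3}ρ₊^{-4}ρ_𝒦^{-1} μ_b`, i.e. [AF] (11.4):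
`μ_b := ρ_𝒥³ρ₊⁴ρ_𝒦|dt dx|`, `ρ_𝒥 = t_*/(t_*+r)`, `ρ₊ = (t_*+r)/(t_* r)`, `ρ_𝒦 = r/(t_*+r)`, "in which case
`ρ_𝒥³ρ₊⁴ρ_𝒦 = 1/(t_* r³)`". [cite: Hintz2026WavesII, eq. (11.4), AF l.10847-10852] -/
def muBExponents : Fin 3 → ℚ := ![3, 4, 1]

/-- The weight shift when an `L²` weight is re-expressed w.r.t. `μ_b` instead of `|dt dx|`:
`∫|u|²ρ^{-2α}|dt dx| = ∫|u|²ρ^{-2(α+w/2)}μ_b` with `w = (3,4,1)`, so `β = α + (3/2, 2, 1/2)` — [AF] (11.5)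
`β_𝒥 = α_𝒥 + 3/2`, `β₊ = α₊ + 2`, and the `𝒦⁺`-orders of (11.3) ↦ (11.6a) shift by `½`.
[cite: Hintz2026WavesII, eq. (11.5)-(11.6a), AF l.10856-10867] -/
def densityShift : Fin 3 → ℚ := ![3 / 2, 2, 1 / 2]

/-- The shift `(3/2, 2, 1/2)` is half of `(3, 4, 1)`. [cite: Hintz2026WavesII, eq. (11.4)-(11.5), AF l.10847-10860] -/
theorem densityShift_eq_half (i : Fin 3) : densityShift i = muBExponents i / 2 := by
  fin_cases i <;> norm_num [densityShift, muBExponents]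

/-- The printed check "ρ_𝒥³ρ₊⁴ρ_𝒦 = 1/(t_* r³)" of [AF] (11.4), as an identity of rational functions in
`t = t_* > 0`, `r > 0`. [cite: Hintz2026WavesII, eq. (11.4), AF l.10850-10852] -/
theorem muB_prefactor (t r : ℝ) (ht : 0 < t) (hr : 0 < r) :
    (t / (t + r)) ^ 3 * ((t + r) / (t * r)) ^ 4 * (r / (t + r)) = 1 / (t * r ^ 3) := by
  have h1 : t + r ≠ 0 := by positivity
  have h2 : t ≠ 0 := ht.ne'
  have h3 : r ≠ 0 := hr.ne'
  field_simp

/-- [AF] (11.5): `β_𝒥 = α_𝒥 + 3/2`. [cite: Hintz2026WavesII, eq. (11.5), AF l.10858-10860] -/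
noncomputable def betaScri (αScri : ℝ) : ℝ := αScri + 3 / 2

/-- [AF] (11.5): `β₊ = α₊ + 2`. [cite: Hintz2026WavesII, eq. (11.5), AF l.10858-10860] -/
noncomputable def betaPlus (αPlus : ℝ) : ℝ := αPlus + 2

/-- The `𝒦⁺`-order of a `|dt dx|`-based weight `γ` when rewritten w.r.t. `μ_b`: `γ + ½`
((11.3) `(−ℵ; 0)` ↦ (11.6a) `(−ℵ+½; ½)`). [cite: Hintz2026WavesII, eq. (11.3) and (11.6a), AF l.10838-10867] -/
noncomputable def kOrderMuB (γ : ℝ) : ℝ := γ + 1 / 2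

/-- [AF] Thm 11.1's hypothesis `α_𝒥 < −½ + S̲` (AF l.10826) is the printed `β_𝒥 < 1 + S̲` (AF l.10858).
[cite: Hintz2026WavesII, Thm 11.1, AF l.10826 and l.10858] -/
theorem hypScri_iff (αScri S : ℝ) : αScri < -1 / 2 + S ↔ betaScri αScri < 1 + S := by
  unfold betaScri; constructor <;> intro h <;> linarith

/-- [AF] Thm 11.1's hypothesis `α₊ < α_𝒥 − ½` (AF l.10826) is the printed `β₊ < β_𝒥` (AF l.10858).
[cite: Hintz2026WavesII, Thm 11.1, AF l.10826 and l.10858] -/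
theorem hypPlus_iff (αScri αPlus : ℝ) : αPlus < αScri - 1 / 2 ↔ betaPlus αPlus < betaScri αScri := by
  unfold betaPlus betaScri; constructor <;> intro h <;> linarith

/-- The sf-weight in the `μ_b`-form: [AF] l.10858 "P₁ be ℵ-admissible with sf-weight `β₊ − 2`" is the
`α₊` of the `|dt dx|`-form. [cite: Hintz2026WavesII, AF l.10858] -/
theorem sfWeight_eq (αPlus : ℝ) : betaPlus αPlus - 2 = αPlus := by unfold betaPlus; ring

/-- (11.3) ↦ (11.6a): the `𝒦⁺`-orders `(−ℵ; 0)` become `(−ℵ+½; ½)`; at `ℵ = 2` these are `(−3/2; ½)` — the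
values printed in Hintz's membership lines (EqDAdmRegu)/(EqDAdmRegf) (H l.11036–11044) and in the H l.1953
footnote ("The `𝒦⁺`-order of `u` is `½ − 2 = −3/2`").
[cite: Hintz2026WavesII, eq. (11.6a), AF l.10862-10867; Hintz2026, Thm (ThmDAdmReg) H l.11036-11044, l.1953] -/
theorem kOrder_muB (ℵ : ℝ) : kOrderMuB (-ℵ) = -ℵ + 1 / 2 ∧ kOrderMuB 0 = 1 / 2 := by
  unfold kOrderMuB; constructor <;> ring

/-- At `ℵ = 2`: `(−3/2; ½)`, and "`½ − 2 = −3/2`" (H l.1953 fn.). [cite: Hintz2026WavesII, eq. (11.6a), AF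
l.10862-10867; Hintz2026, H l.1953] -/
theorem kOrder_muB_aleph_two : kOrderMuB (-2) = -3 / 2 ∧ kOrderMuB 0 = 1 / 2 ∧ (1 / 2 : ℝ) - 2 = -3 / 2 := by
  unfold kOrderMuB; norm_num

/-- **DIVERGENCE SRC-A27 (cell `pub-kerr`), the arithmetic.**  Hintz's tame estimate (EqDAdmRegTame)
(H l.11046–11048) prints the `𝒦⁺`-orders `−2` (for `u`) and `0` (for `f`): these are the `|dt dx|`-based
exponents of [AF] (11.3) at `ℵ = 2`, whereas the theorem's own convention is `μ_b` (H l.10742, l.11024) under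
which [AF] (11.6a) — and Hintz's membership lines (EqDAdmRegu)/(EqDAdmRegf) two lines earlier — print
`−3/2` and `½`.  The two triples differ by exactly the density shift `½` and are not equal.
[cite: Hintz2026, eq. (EqDAdmRegTame) H l.11046-11048 vs (EqDAdmRegu)/(EqDAdmRegf) H l.11036-11044;
Hintz2026WavesII, (11.3) AF l.10838-10841 and (11.6a) AF l.10862-10867] -/
theorem srcA27 :
    (kOrderMuB (-2) = -3 / 2 ∧ kOrderMuB 0 = 1 / 2) ∧ ((-2 : ℝ) ≠ -3 / 2 ∧ (0 : ℝ) ≠ 1 / 2) ∧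
      ((-3 / 2 : ℝ) - (-2) = 1 / 2 ∧ (1 / 2 : ℝ) - 0 = 1 / 2) := by
  unfold kOrderMuB; norm_num

/-! ## §2  Hintz Thm `ThmDAdmReg`'s printed parameters versus [AF] Thm 11.1 / Hintz Thm `ThmAdm` -/

/-- The printed hypotheses of Hintz Thm `ThmDAdmReg` (H l.11028): "Let `β₊ ∈ (½, ½+ε_ind)` and
`β_𝒥 ∈ (β₊, 1)`; fix `δ > β₊ − ½`."  (`εInd` = the indicial-gap parameter `ε_ind` of (EqWEIndEps).)
[cite: Hintz2026, Thm (ThmDAdmReg) H l.11028 (transcription; claim under review)] -/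
structure RegParams where
  /-- `β₊`, the `ι⁺`-weight (μ_b-convention) -/
  βPlus : ℝ
  /-- `β_𝒥`, the `𝒥⁺`-weight -/
  βScri : ℝ
  /-- `δ`, the sf-loss -/
  δ : ℝ
  /-- `ε_ind`, right end point of the indicial gap `(0, ε_ind)` of `L̂_b(0)` -/
  εInd : ℝ
  βPlus_lo : 1 / 2 < βPlus
  βPlus_hi : βPlus < 1 / 2 + εInd
  βScri_lo : βPlus < βScri
  βScri_hi : βScri < 1
  δ_lo : βPlus - 1 / 2 < δ

namespace RegParams

variable (p : RegParams)

/-- The sf-weight [AF] Thm 11.1 is applied with, in the `μ_b`-form: `α_sf := β₊ − 2` (AF l.10858).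
[cite: Hintz2026WavesII, AF l.10858] -/
def αsf : ℝ := p.βPlus - 2

/-- The printed window `(½, ½+ε_ind)` is nonempty only for `ε_ind > 0`. [cite: Hintz2026, Thm (ThmDAdmReg) H l.11028] -/
theorem εInd_pos : 0 < p.εInd := by linarith [p.βPlus_lo, p.βPlus_hi]

/-- **Hintz Thm `ThmAdm`'s hypothesis is met exactly**: "Let `α_sf ∈ ℝ` be such that `α_sf + 3/2 ∈ (0, ε_ind)`"
(H l.9790) ⟸ `β₊ ∈ (½, ½+ε_ind)` with `α_sf = β₊ − 2`; the converse direction `window_iff` shows the two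
printed windows are the SAME window. [cite: Hintz2026, Thm (ThmAdm) H l.9789-9791 and Thm (ThmDAdmReg) H l.11028] -/
theorem thmAdm_window : 0 < p.αsf + 3 / 2 ∧ p.αsf + 3 / 2 < p.εInd := by
  unfold αsf; constructor <;> linarith [p.βPlus_lo, p.βPlus_hi]

/-- `α_sf + 3/2 ∈ (0, ε_ind)` with `α_sf = β₊ − 2` iff `β₊ ∈ (½, ½+ε_ind)`. [cite: Hintz2026, Thm (ThmAdm) H
l.9790 and Thm (ThmDAdmReg) H l.11028] -/
theorem window_iff (βPlus εInd : ℝ) :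
    (0 < (βPlus - 2) + 3 / 2 ∧ (βPlus - 2) + 3 / 2 < εInd) ↔ (1 / 2 < βPlus ∧ βPlus < 1 / 2 + εInd) := by
  constructor <;> rintro ⟨h1, h2⟩ <;> exact ⟨by linarith, by linarith⟩

/-- "… and let `δ > α_sf + 3/2`" (H l.9790) is "fix `δ > β₊ − ½`" (H l.11028).
[cite: Hintz2026, Thm (ThmAdm) H l.9790 and Thm (ThmDAdmReg) H l.11028] -/
theorem thmAdm_loss : p.αsf + 3 / 2 < p.δ := by
  unfold αsf; linarith [p.δ_lo]

/-- `δ > α_sf + 3/2` with `α_sf = β₊ − 2` iff `δ > β₊ − ½`. [cite: Hintz2026, Thm (ThmAdm) H l.9790 and Thm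
(ThmDAdmReg) H l.11028] -/
theorem loss_iff (βPlus δ : ℝ) : (βPlus - 2) + 3 / 2 < δ ↔ βPlus - 1 / 2 < δ := by
  constructor <;> intro h <;> linarith

/-- [AF] Thm 11.1 (μ_b-form, AF l.10858): "`β_𝒥 < 1 + S̲`" holds for Hintz's `β_𝒥 < 1` as soon as `S̲ ≥ 0`;
Hintz prints `min spec S̲_{E̲^Υ,E̲^𝓒} = 0` (H l.7359) and "min spec `S̲ = 0`" (H l.8225).
[cite: Hintz2026WavesII, Thm 11.1, AF l.10858; Hintz2026, H l.7359, l.8225, l.11028] -/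
theorem af111_scri (S : ℝ) (hS : 0 ≤ S) : p.βScri < 1 + S := by linarith [p.βScri_hi]

/-- [AF] Thm 11.1 (μ_b-form, AF l.10858): "`β₊ < β_𝒥`" is Hintz's `β_𝒥 ∈ (β₊, 1)`.
[cite: Hintz2026WavesII, Thm 11.1, AF l.10858; Hintz2026, H l.11028] -/
theorem af111_plus : p.βPlus < p.βScri := p.βScri_lo

/-- [AF] records (AF l.5500) 2-admissibility "with sf-weight `α_sf ∈ (−3/2, −½)` and any sf-loss
`δ > α_sf + 3/2`", and [AF] Thm 14.2's toy range is the same; Hintz's window lies inside it once `ε_ind ≤ 1`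
(indeed `ε_ind ≤ ½` by (EqWEIndEps)). [cite: Hintz2026WavesII, AF l.5500 and Thm 14.2 AF l.12480;
Hintz2026, (EqWEIndEps) H l.7566] -/
theorem af142_range (hε : p.εInd ≤ 1) : -3 / 2 < p.αsf ∧ p.αsf < -1 / 2 := by
  unfold αsf; constructor <;> linarith [p.βPlus_lo, p.βPlus_hi]

/-- The `ι⁺`-order of the solution in (EqDAdmRegu), `β₊ − δ`, is always `< ½` …
[cite: Hintz2026, (EqDAdmRegu) H l.11040-11042 and H l.11363] -/
theorem iotaOrder_lt_half : p.βPlus - p.δ < 1 / 2 := by linarith [p.δ_lo]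

/-- … and the `𝒥⁺`-order `β_𝒥` is `< 1`; together with `exists_params_near` this is the sentence "Theorem
`ThmDAdmReg` gives `u ∈ H_b^{∞,(1−ε, ½−ε, −3/2)}(Ω_*;S²𝒯*)` for all `ε > 0`" (H l.11363).
[cite: Hintz2026, H l.11363] -/
theorem scriOrder_lt_one : p.βScri < 1 := p.βScri_hi

end RegParams

/-- For every `ε_ind > 0` and every `η > 0` there are admissible parameters with `β₊ − δ > ½ − η` and
`β_𝒥 > 1 − η`: the orders `(1−ε, ½−ε)` of H l.11363 are attained up to `ε`, never reached.
[cite: Hintz2026, Thm (ThmDAdmReg) H l.11028 and H l.11363] -/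
theorem exists_params_near (εInd η : ℝ) (hε : 0 < εInd) (hη : 0 < η) :
    ∃ p : RegParams, p.εInd = εInd ∧ 1 / 2 - η < p.βPlus - p.δ ∧ 1 - η < p.βScri := by
  set m : ℝ := min εInd (min η (1 / 2)) with hm
  have hm0 : 0 < m := lt_min hε (lt_min hη (by norm_num))
  have hmε : m ≤ εInd := min_le_left _ _
  have hmη : m ≤ η := (min_le_right _ _).trans (min_le_left _ _)
  have hmh : m ≤ 1 / 2 := (min_le_right _ _).trans (min_le_right _ _)
  refine ⟨⟨1 / 2 + m / 4, 1 - m / 4, m / 2, εInd, by linarith, by linarith, by linarith, by linarith,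
    by linarith⟩, rfl, ?_, ?_⟩
  · show 1 / 2 - η < 1 / 2 + m / 4 - m / 2
    linarith
  · show 1 - η < 1 - m / 4
    linarith

/-- "Recall from Theorem `ThmAdm` that for fixed `α_sf ∈ (−3/2, −3/2+ε_ind)`, the operator `L_b` is 2-admissible
with sf-loss `δ`, where `δ > α_sf + 3/2 ∈ (0, ε_ind)` can be taken to be `< ε_ind` (and thus `< 1`)" (H l.11007),
given `ε_ind ≤ ½` ((EqWEIndEps): `ε_ind ≤ d(Re λ, ℤ) ≤ ½`).
[cite: Hintz2026, H l.11007 and (EqWEIndEps) H l.7566] -/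
theorem exists_delta_lt_one (αsf εInd : ℝ) (h1 : -3 / 2 < αsf) (h2 : αsf < -3 / 2 + εInd)
    (hε : εInd ≤ 1 / 2) : ∃ δ : ℝ, αsf + 3 / 2 < δ ∧ δ < εInd ∧ δ < 1 := by
  refine ⟨(αsf + 3 / 2 + εInd) / 2, by linarith, by linarith, by linarith⟩

/-- The distance of a real number to the integers is at most `½`; hence (EqWEIndEps) ("`d(Re λ, ℤ) ≥ ε_ind` for
all non-integer indicial roots `λ` with `|λ| ≤ 50`", H l.7566) forces `ε_ind ≤ ½` as soon as one such root
exists (e.g. `λ^Υ_{s1,1} ∈ (0, ¼)`, H (EqWGIndRoots)). Stated for the representative `λ − ⌊λ⌋ ∈ [0,1)`.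
[cite: Hintz2026, (EqWEIndEps) H l.7566] -/
theorem dist_int_le_half (x : ℝ) : min (x - ⌊x⌋) (⌊x⌋ + 1 - x) ≤ 1 / 2 := by
  have h1 : (⌊x⌋ : ℝ) ≤ x := Int.floor_le x
  have h2 : x < ⌊x⌋ + 1 := Int.lt_floor_add_one x
  by_cases h : x - ⌊x⌋ ≤ 1 / 2
  · exact (min_le_left _ _).trans h
  · have h' : 1 / 2 < x - ⌊x⌋ := lt_of_not_ge h
    exact (min_le_right _ _).trans (by linarith)

/-- **(EqWEIndEps) keeps indicial roots away from integers from below (and above).**  If `x` is an integer, or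
its distance to `ℤ` is at least `ε_ind` (H l.7566: "`d(Re λ, ℤ) ≥ ε_ind` for all non-integer indicial roots `λ`
with `|λ| ≤ 50`"), and `ε_ind ≤ 1`, then `x ∉ (n − ε_ind, n)` for every integer `n` — the content of "uses that such
`α` are not the real part of any indicial root of `L̂_b(0)`" for `α ∈ (−1−ε_ind, −1)` (H l.8066, `n = −1`; e.g. the
s1-root `−λ^Υ_{s1,2} + 1 ≈ −1` of Lemma `LemmaWEInd`, H l.7545). [cite: Hintz2026, (EqWEIndEps) H l.7564-7568 and
H l.8066; Lemma (LemmaWEInd) H l.7540-7562] -/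
theorem no_root_near_integer (x εInd : ℝ) (n : ℤ) (hε : εInd ≤ 1)
    (hx : (∃ m : ℤ, x = m) ∨ εInd ≤ min (x - ⌊x⌋) (⌊x⌋ + 1 - x)) :
    ¬ ((n : ℝ) - εInd < x ∧ x < n) := by
  rintro ⟨h1, h2⟩
  rcases hx with ⟨m, rfl⟩ | hd
  · have h3 : ((n : ℝ) - 1) < (m : ℝ) := by linarith
    have h4 : n - 1 < m := by exact_mod_cast h3
    have h5 : m < n := by exact_mod_cast h2
    omega
  · have hfl : ⌊x⌋ = n - 1 := by
      rw [Int.floor_eq_iff]; push_cast; constructor <;> linarith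
    have hcast : ((⌊x⌋ : ℤ) : ℝ) = (n : ℝ) - 1 := by rw [hfl]; push_cast; ring
    have hmin : min (x - ⌊x⌋) (⌊x⌋ + 1 - x) ≤ ⌊x⌋ + 1 - x := min_le_right _ _
    linarith

/-- The symmetric statement from above: `x ∉ (n, n + ε_ind)`. [cite: Hintz2026, (EqWEIndEps) H l.7564-7568] -/
theorem no_root_near_integer' (x εInd : ℝ) (n : ℤ) (hε : εInd ≤ 1)
    (hx : (∃ m : ℤ, x = m) ∨ εInd ≤ min (x - ⌊x⌋) (⌊x⌋ + 1 - x)) :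
    ¬ ((n : ℝ) < x ∧ x < n + εInd) := by
  rintro ⟨h1, h2⟩
  rcases hx with ⟨m, rfl⟩ | hd
  · have h4 : n < m := by exact_mod_cast h1
    have h3 : (m : ℝ) < (n : ℝ) + 1 := by linarith
    have h5 : m < n + 1 := by exact_mod_cast h3
    omega
  · have hfl : ⌊x⌋ = n := by
      rw [Int.floor_eq_iff]; constructor <;> linarith
    have hcast : ((⌊x⌋ : ℤ) : ℝ) = (n : ℝ) := by rw [hfl]
    have hmin : min (x - ⌊x⌋) (⌊x⌋ + 1 - x) ≤ x - ⌊x⌋ := min_le_left _ _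
    linarith

/-! ## §3  Cor `CorDAdm`: the weight box is supply ∩ demand; regularity indices -/

/-- SUPPLY — Lemma `LemmaDAdmMet` (EqDAdmMetells) (H l.10868–10871): `h ∈ 𝒳^k` lies in
`𝒢̃_b^{k−3,(2ℓ_𝒥,ℓ₊,ℓ_𝒦)}` "provided that `ℓ_𝒥 < min(2γ^Υ, ½)`, `ℓ₊ < 1`, `ℓ_𝒦 ≤ 2+ε_𝒦`".
[cite: Hintz2026, Lemma (LemmaDAdmMet) eq. (EqDAdmMetells) H l.10868-10871] -/
def metSupply (γU εK ℓscri ℓplus ℓK : ℝ) : Prop :=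
  ℓscri < min (2 * γU) (1 / 2) ∧ ℓplus < 1 ∧ ℓK ≤ 2 + εK

/-- DEMAND — [AF] Def 5.18, (5.23) `EqSDWAdmWeights` (AF l.5607–5611): "Let `ℓ_𝒥, ℓ₊, ℓ_𝒦 > 0` be such that
`ℓ_𝒥 ∈ (0, ½]`, `ℓ₊ > δ`, `ℓ_𝒦 > ℵ`." [cite: Hintz2026WavesII, Def 5.18 eq. (5.23), AF l.5605-5611] -/
def afDemand (ℵ δ ℓscri ℓplus ℓK : ℝ) : Prop :=
  (0 < ℓscri ∧ ℓscri ≤ 1 / 2) ∧ (0 < ℓplus ∧ δ < ℓplus) ∧ (0 < ℓK ∧ ℵ < ℓK)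

/-- [AF] Def 5.15 `DefSDGMetric` (AF l.5520): "Let `ℓ_𝒥 ∈ [0, ½]`, `ℓ₊ ∈ [0, 1]`, `ℓ_𝒦 ≥ 0`" — the ranges in
which asymptotically Kerr metric classes are defined (Def 5.18 item (1) refers to them).
[cite: Hintz2026WavesII, Def 5.15, AF l.5519-5521] -/
def afMetricRanges (ℓscri ℓplus ℓK : ℝ) : Prop :=
  (0 ≤ ℓscri ∧ ℓscri ≤ 1 / 2) ∧ (0 ≤ ℓplus ∧ ℓplus ≤ 1) ∧ 0 ≤ ℓK

/-- THE PRINTED BOX — Cor `CorDAdm` (H l.11012–11014): admissible of class `((0;k−5),(2ℓ_𝒥,ℓ₊,ℓ_𝒦))` "for all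
`ℓ_𝒥 < min(2γ^Υ, ½)`, `ℓ₊ ∈ (δ, 1)`, and `ℓ_𝒦 ∈ (2, 2+ε_𝒦]`" (positivity of `ℓ_𝒥` being [AF] Def 5.18's
standing "`ℓ_𝒥, ℓ₊, ℓ_𝒦 > 0`"). [cite: Hintz2026, Cor (CorDAdm) H l.11010-11014 (transcription; claim under review)] -/
def corDAdmBox (γU εK δ ℓscri ℓplus ℓK : ℝ) : Prop :=
  (0 < ℓscri ∧ ℓscri < min (2 * γU) (1 / 2)) ∧ (δ < ℓplus ∧ ℓplus < 1) ∧ (2 < ℓK ∧ ℓK ≤ 2 + εK)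

/-- **Cor `CorDAdm`'s box = supply ∩ demand at `ℵ = 2`** (for `δ ≥ 0`, [AF] Def 5.18's "`ℵ, δ ≥ 0`"): the
printed triple of ranges is exactly the set of weights for which Lemma `LemmaDAdmMet` places `h` in [AF]'s
coefficient class AND [AF] (5.23) holds with `ℵ = 2` — the proof's closing sentence "The weights `ℓ₊ ∈ (δ,1)`
and `ℓ_𝒦 > 2` satisfy the conditions in [AF, (5.23)]" (H l.11022) together with its converse.
[cite: Hintz2026, Cor (CorDAdm) H l.11012-11014 and proof H l.11022, (EqDAdmMetells) H l.10868-10871;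
Hintz2026WavesII, (5.23) AF l.5607-5611] -/
theorem corDAdmBox_iff (γU εK δ ℓscri ℓplus ℓK : ℝ) (hδ : 0 ≤ δ) :
    corDAdmBox γU εK δ ℓscri ℓplus ℓK ↔
      (metSupply γU εK ℓscri ℓplus ℓK ∧ afDemand 2 δ ℓscri ℓplus ℓK) := by
  unfold corDAdmBox metSupply afDemand
  have hmin : min (2 * γU) (1 / 2) ≤ 1 / 2 := min_le_right _ _
  constructor
  · rintro ⟨⟨h1, h2⟩, ⟨h3, h4⟩, ⟨h5, h6⟩⟩
    exact ⟨⟨h2, h4, h6⟩, ⟨h1, by linarith⟩, ⟨by linarith, h3⟩, ⟨by linarith, h5⟩⟩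
  · rintro ⟨⟨h2, h4, h6⟩, ⟨h1, _⟩, ⟨_, h3⟩, ⟨_, h5⟩⟩
    exact ⟨⟨h1, h2⟩, ⟨h3, h4⟩, ⟨h5, h6⟩⟩

/-- The box lies inside [AF] Def 5.15's ranges (so Def 5.18 item (1)'s metric class is defined there).
[cite: Hintz2026WavesII, Def 5.15, AF l.5520; Hintz2026, Cor (CorDAdm) H l.11012-11014] -/
theorem corDAdmBox_afMetricRanges {γU εK δ ℓscri ℓplus ℓK : ℝ} (hδ : 0 ≤ δ)
    (h : corDAdmBox γU εK δ ℓscri ℓplus ℓK) : afMetricRanges ℓscri ℓplus ℓK := by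
  obtain ⟨⟨h1, h2⟩, ⟨h3, h4⟩, ⟨h5, _⟩⟩ := h
  have hmin : min (2 * γU) (1 / 2) ≤ 1 / 2 := min_le_right _ _
  exact ⟨⟨h1.le, by linarith⟩, ⟨by linarith, h4.le⟩, by linarith⟩

/-- Remark `RmkDAdmRegh` (H l.11017): "it would suffice that … `ℓ_𝒥 < min(2γ^Υ, ½)`, `0 < ℓ₊ < 1`, and
`ℓ_𝒦 > 2`" — a box containing the corollary's (for `δ ≥ 0`).
[cite: Hintz2026, Remark (RmkDAdmRegh) H l.11017] -/
theorem corDAdmBox_sub_rmk {γU εK δ ℓscri ℓplus ℓK : ℝ} (hδ : 0 ≤ δ)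
    (h : corDAdmBox γU εK δ ℓscri ℓplus ℓK) :
    ℓscri < min (2 * γU) (1 / 2) ∧ (0 < ℓplus ∧ ℓplus < 1) ∧ 2 < ℓK := by
  obtain ⟨⟨_, h2⟩, ⟨h3, h4⟩, ⟨h5, _⟩⟩ := h
  exact ⟨h2, ⟨by linarith, h4⟩, h5⟩

/-- **The box is inhabited iff `γ^Υ > 0`, `δ < 1`, `ε_𝒦 > 0`** — the reason H l.11007 records "`δ` … can be
taken to be `< ε_ind` (and thus `< 1`)" before stating the corollary; `γ^Υ > 0` is (EqExOpParam) (H l.5059)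
and `ε_𝒦 > 0` is (EqDMetBasicEllEps) (H l.10796).
[cite: Hintz2026, Cor (CorDAdm) H l.11012-11014, H l.11007, (EqDMetBasicEllEps) H l.10796] -/
theorem corDAdmBox_nonempty_iff (γU εK δ : ℝ) :
    (∃ ℓscri ℓplus ℓK : ℝ, corDAdmBox γU εK δ ℓscri ℓplus ℓK) ↔ (0 < γU ∧ δ < 1 ∧ 0 < εK) := by
  constructor
  · rintro ⟨ℓscri, ℓplus, ℓK, ⟨h1, h2⟩, ⟨h3, h4⟩, ⟨h5, h6⟩⟩
    have ha : ℓscri < 2 * γU := lt_of_lt_of_le h2 (min_le_left _ _)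
    exact ⟨by linarith, by linarith, by linarith⟩
  · rintro ⟨hγ, hδ, hε⟩
    refine ⟨min γU (1 / 4), (δ + 1) / 2, 2 + εK, ⟨lt_min hγ (by norm_num), ?_⟩,
      ⟨by linarith, by linarith⟩, ⟨by linarith, le_rfl⟩⟩
    have h1 : min γU (1 / 4) ≤ γU := min_le_left _ _
    have h2 : min γU (1 / 4) ≤ 1 / 4 := min_le_right _ _
    exact lt_min (by linarith) (by linarith)

/-! ### Regularity indices in the proof of Cor `CorDAdm` (ℕ-valued bookkeeping) -/

/-- b-Sobolev embedding on the 4-dimensional `Ω_*` costs 3 derivatives in Hintz's integer count: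
Lemma `LemmaDAdmMet` maps `𝒳^k → 𝒢̃_b^{k−3}` (H l.10866, "Sobolev embedding (see [AF, Lemma 3.22])"), and the
proof of Cor `CorDAdm` embeds `H_b^{k−2} ⊂ 𝒞_b^{k−5}` (H l.11021).
[cite: Hintz2026, H l.10866 and l.11021; Hintz2026WavesII, Lemma 3.22] -/
def sobolevLoss : ℕ := 3

/-- Prop `PropDAdmLin` (H l.10938–10948): metric coefficients in `H_b^k` give error coefficients of `L_{g,g⁰}`
in `H_b^{k−2}` ("differences of Christoffel symbols … `H_b^{k−1}` … curvature components … `H_b^{k−2}`",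
H l.10976). [cite: Hintz2026, Prop (PropDAdmLin) (EqDAdmLeb) H l.10945-10948 and proof H l.10976] -/
def curvatureLoss : ℕ := 2

/-- The class index printed in Cor `CorDAdm`: `(d₀; k) ↦ (0; k−5)` (H l.11013, l.11021).
[cite: Hintz2026, Cor (CorDAdm) H l.11013 and l.11021] -/
def corDAdmClass (k : ℕ) : ℕ := k - 5

/-- `k − 5 = k − (2 + 3)`. [cite: Hintz2026, Cor (CorDAdm) H l.11013 and proof H l.11021] -/
theorem corDAdmClass_eq (k : ℕ) : corDAdmClass k = k - (curvatureLoss + sobolevLoss) := by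
  unfold corDAdmClass curvatureLoss sobolevLoss; omega

/-- [AF] Def 5.18 item (1) needs `g ∈ 𝒢^{(0;k−5)}`; Lemma `LemmaDAdmMet` gives `𝒢̃_b^{k−3} ⊂ 𝒢̃_b^{k−5}`
(margin 2). [cite: Hintz2026, Lemma (LemmaDAdmMet) H l.10864-10866; Hintz2026WavesII, Def 5.18(1) AF l.5615] -/
theorem metric_margin (k : ℕ) : corDAdmClass k ≤ k - sobolevLoss ∧ (k - sobolevLoss) - corDAdmClass k ≤ 2 := by
  unfold corDAdmClass sobolevLoss; omega

/-- [AF] (5.24) `EqSDWp0p1` needs `p₀, p̃₁ ∈ ρ₊^{ℓ₊}𝒞_b^{k+d₀}` with `(d₀;k)` replaced by `(0;k−5)`, i.e.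
`𝒞_b^{k−5}`; Hintz: "these lie in `ρ₊^{ℓ₊}𝒞_b^{k−4}`" (H l.11021) — margin 1.
[cite: Hintz2026, proof of Cor (CorDAdm) H l.11021; Hintz2026WavesII, (5.24) AF l.5618-5621] -/
theorem p_margin (k : ℕ) : corDAdmClass k + 0 ≤ k - 4 ∧ (k - 4) - corDAdmClass k ≤ 1 := by
  unfold corDAdmClass; omega

/-- **The `d`-bookkeeping.**  [AF] Thm 11.1 takes `P` of class `((0;k+d),…)` and `f ∈ H_b^{k+d}` to
`u ∈ H_b^k` (AF l.10830–10836); Hintz takes `h ∈ 𝒳^{k+d}` (H l.11033), which by Cor `CorDAdm` yields class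
`(0; k+d−5)`.  So [AF]'s theorem with loss `d_AF` applies at [AF]-regularity `k + d_AF ≤ (k + d_H) − 5` as soon
as `d_H ≥ d_AF + 5` — "up to increasing `d` further by a constant amount" (H l.11052); `d` is existentially
quantified on both sides ("There exist `ε₀, d ∈ ℕ`"). [cite: Hintz2026, Thm (ThmDAdmReg) H l.11028-11033 and
H l.11052; Hintz2026WavesII, Thm 11.1 AF l.10828-10836] -/
theorem d_bookkeeping (k dAF dH : ℕ) (h : dAF + 5 ≤ dH) : k + dAF ≤ corDAdmClass (k + dH) := by
  unfold corDAdmClass; omega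

/-- … and conversely the shift by `5` is exactly what is needed (for `k + d_H ≥ 5`). [cite: Hintz2026, H l.11052] -/
theorem d_bookkeeping_iff (k dAF dH : ℕ) (hk : 5 ≤ k + dH) :
    k + dAF ≤ corDAdmClass (k + dH) ↔ dAF + 5 ≤ dH := by
  unfold corDAdmClass; omega

/-! ## §4  [AF] Def 5.18(3): the printed `A_h` is lower triangular, `B_h` strictly, in (EqExOpLinSplit) -/

section Splitting

open Matrix

variable {R : Type*} [Field R]

/-- Position `i` of the splitting (EqExOpLinSplit) (H l.4764: `⟨(dx⁰)²⟩ ⊕ (2dx⁰⊗_s rT*𝕊²) ⊕ ⟨r²g̸⟩ ⊕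
⟨2dx⁰dx¹⟩ ⊕ (2dx¹⊗_s rT*𝕊²) ⊕ r²ker t̸r ⊕ ⟨(dx¹)²⟩`) ↦ its position in (EqKNullS2TFine) (H l.3923:
`⟨(dx⁰)²⟩ ⊕ ⟨2dx⁰dx¹⟩ ⊕ (2dx⁰⊗_s rT*𝕊²) ⊕ ⟨(dx¹)²⟩ ⊕ (2dx¹⊗_s rT*𝕊²) ⊕ ⟨r²g̸⟩ ⊕ r²ker t̸r`), 0-indexed.
[cite: Hintz2026, (EqExOpLinSplit) H l.4764-4768 and (EqKNullS2TFine) H l.3923-3928] -/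
def toFine : Fin 7 → Fin 7 := ![0, 2, 5, 1, 4, 6, 3]

/-- The inverse relabelling (EqKNullS2TFine) ↦ (EqExOpLinSplit).
[cite: Hintz2026, (EqExOpLinSplit) H l.4764-4768 and (EqKNullS2TFine) H l.3923-3928] -/
def toCoarse : Fin 7 → Fin 7 := ![0, 3, 1, 6, 4, 2, 5]

/-- `toCoarse ∘ toFine = id`. [cite: Hintz2026, (EqExOpLinSplit) H l.4764 and (EqKNullS2TFine) H l.3923] -/
theorem toCoarse_toFine (i : Fin 7) : toCoarse (toFine i) = i := by
  fin_cases i <;> rfl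

/-- `toFine ∘ toCoarse = id`. [cite: Hintz2026, (EqExOpLinSplit) H l.4764 and (EqKNullS2TFine) H l.3923] -/
theorem toFine_toCoarse (i : Fin 7) : toFine (toCoarse i) = i := by
  fin_cases i <;> rfl

/-- The relabelling is a permutation of the seven summands ("in a certain permutation of the summands of
(EqKNullS2TFine)", H l.4368). [cite: Hintz2026, H l.4368, (EqExOpLinSplit) H l.4764, (EqKNullS2TFine) H l.3923] -/
def splitPerm : Equiv.Perm (Fin 7) where
  toFun := toFine
  invFun := toCoarse
  left_inv := toCoarse_toFine
  right_inv := toFine_toCoarse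

/-- **Hintz 2026, `A_h` of eq. (EqExOpLinAB)** (H l.4772–4783), transcribed positionally in the splitting
(EqExOpLinSplit); parameters `v e γ` = `(v^𝓒, e^𝓒, γ^𝓒)`, `eU γU` = `(e^Υ, γ^Υ)`; symbols as in
`ExteriorNormalOperator.hintzA`: `a = ∂₁(r h_{01})`, `b = ∂₁(r h_1{}^{ā})`, `c = ∂₁(r h_{1ā})`,
`dd = ∂₁(r h^{āb̄})`, `ee = ∂₁(r h_{āb̄})`.  Printed rows: `(2(1−v)γ,0,…,0)`, `(0,(1−v)γ,0,…,0)`,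
`(2(1−e)(1+v)γ,0,(1−e)(1−v)γ,0,0,0,0)`, `(e(1+v)γ+γU+2a, 0, ½(e(1−v)γ+eU γU), (1−eU)γU, 0,0,0)`,
`(2c, (1+v)γ+γU, 0, 0, γU, 0, 0)`, `(2ee,0,…,0)`, `(0, 2b, (1+v)γ+eU γU−2a, 2(1−eU)γU, 0, −½dd, 2γU)`.
[cite: Hintz2026, eq. (EqExOpLinAB) H l.4772-4783 (transcription; claim under review)] -/
def exA (v e γ eU γU a b c dd ee : R) : Matrix (Fin 7) (Fin 7) R :=
  !![2 * (1 - v) * γ, 0, 0, 0, 0, 0, 0;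
     0, (1 - v) * γ, 0, 0, 0, 0, 0;
     2 * (1 - e) * (1 + v) * γ, 0, (1 - e) * (1 - v) * γ, 0, 0, 0, 0;
     e * (1 + v) * γ + γU + 2 * a, 0, (e * (1 - v) * γ + eU * γU) / 2, (1 - eU) * γU, 0, 0, 0;
     2 * c, (1 + v) * γ + γU, 0, 0, γU, 0, 0;
     2 * ee, 0, 0, 0, 0, 0, 0;
     0, 2 * b, (1 + v) * γ + eU * γU - 2 * a, 2 * (1 - eU) * γU, 0, -(dd / 2), 2 * γU]

/-- **Hintz 2026, `B_h` of eq. (EqExOpLinAB)** (H l.4784–4795), splitting (EqExOpLinSplit); symbols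
`a2 = ∂₁²(r h_{01})`, `c2 = ∂₁²(r h_{1ā})`, `e2 = ∂₁²(r h_{āb̄})`, `p2 = ∂₁²(r h_{11})`.  Printed: rows 1–3 zero,
rows 4–7 = `(2a2,0,…)`, `(2c2,0,…)`, `(2e2,0,…)`, `(2p2,0,…)`.
[cite: Hintz2026, eq. (EqExOpLinAB) H l.4784-4795 (transcription; claim under review)] -/
def exB (a2 c2 e2 p2 : R) : Matrix (Fin 7) (Fin 7) R :=
  !![0, 0, 0, 0, 0, 0, 0;
     0, 0, 0, 0, 0, 0, 0;
     0, 0, 0, 0, 0, 0, 0;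
     2 * a2, 0, 0, 0, 0, 0, 0;
     2 * c2, 0, 0, 0, 0, 0, 0;
     2 * e2, 0, 0, 0, 0, 0, 0;
     2 * p2, 0, 0, 0, 0, 0, 0]

/-- **Hintz 2026, `B_h` of eq. (EqExOpLinAhBh)** (H l.5017–5025), splitting (EqKNullS2TFine) (the companion of
`ExteriorNormalOperator.hintzA`, which transcribes the `A_h` of the same display).  Printed: rows
`0, (2a2,0,…), 0, (2p2,0,…), (2c2,0,…), 0, (2e2,0,…)`.
[cite: Hintz2026, eq. (EqExOpLinAhBh) H l.5017-5025 (transcription; claim under review)] -/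
def hintzB (a2 c2 e2 p2 : R) : Matrix (Fin 7) (Fin 7) R :=
  !![0, 0, 0, 0, 0, 0, 0;
     2 * a2, 0, 0, 0, 0, 0, 0;
     0, 0, 0, 0, 0, 0, 0;
     2 * p2, 0, 0, 0, 0, 0, 0;
     2 * c2, 0, 0, 0, 0, 0, 0;
     0, 0, 0, 0, 0, 0, 0;
     2 * e2, 0, 0, 0, 0, 0, 0]

/-- **"Upon passing to the splitting (EqExOpLinSplit), one obtains the expressions (EqExOpLinAB)" (H l.5027),
made literal for `A_h`**: the (EqExOpLinAB) matrix is the (EqExOpLinAhBh) matrix (`ExteriorNormalOperator.hintzA`)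
with rows and columns relabelled by `toFine` — an entry-by-entry cross-check of two printed 7×7 displays.
[cite: Hintz2026, (EqExOpLinAhBh) H l.5005-5016, H l.5027, (EqExOpLinAB) H l.4772-4783] -/
theorem exA_eq_submatrix (v e γ eU γU a b c dd ee : R) :
    exA v e γ eU γU a b c dd ee =
      (ExteriorNormalOperator.hintzA v e γ eU γU a b c dd ee).submatrix toFine toFine := by
  ext i j
  fin_cases i <;> fin_cases j <;>
    simp [exA, ExteriorNormalOperator.hintzA, toFine, Matrix.submatrix_apply]

/-- The same cross-check for `B_h`. [cite: Hintz2026, (EqExOpLinAhBh) H l.5017-5025, H l.5027, (EqExOpLinAB)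
H l.4784-4795] -/
theorem exB_eq_submatrix (a2 c2 e2 p2 : R) :
    exB a2 c2 e2 p2 = (hintzB a2 c2 e2 p2).submatrix toFine toFine := by
  ext i j
  fin_cases i <;> fin_cases j <;> simp [exB, hintzB, toFine, Matrix.submatrix_apply]

/-- **[AF] Def 5.18(3), first clause, for the printed matrix**: "the operator `A_h` is lower triangular"
(H l.4770) in (EqExOpLinSplit) — every entry strictly above the diagonal is `0`.  (Hintz: "`p₁` in the notation
of [AF, Definition 5.18(3)] is equal to `A₀ + (A_h − A₀) = A_h`, and thus the required bundle splitting in which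
`p₁` is lower triangular … is given by (EqExOpLinSplit)", H l.11021.)
[cite: Hintz2026, H l.4770 and H l.11021; Hintz2026WavesII, Def 5.18(3) AF l.5626] -/
theorem exA_lower (v e γ eU γU a b c dd ee : R) (i j : Fin 7) (hij : i < j) :
    exA v e γ eU γU a b c dd ee i j = 0 := by
  fin_cases i <;> fin_cases j <;> simp_all [exA]

/-- **[AF] Def 5.18(3), second clause, for the printed matrix**: "`B_h` is strictly lower triangular"
(H l.4770), so `p₀ = 4ρ₊⁻¹B_h|_{𝒥⁺}` (H l.11021) is — every entry on or above the diagonal is `0`.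
[cite: Hintz2026, H l.4770 and H l.11021; Hintz2026WavesII, Def 5.18(3) AF l.5626] -/
theorem exB_strictLower (a2 c2 e2 p2 : R) (i j : Fin 7) (hij : i ≤ j) : exB a2 c2 e2 p2 i j = 0 := by
  fin_cases i <;> fin_cases j <;> simp_all [exB]

/-- The diagonal of the printed `A_h` in (EqExOpLinSplit) — the "diagonal entries `p_{1,jj}`" of [AF]
Def 5.18(3), scalar multiples of the identity on each summand (hence of real spectrum for real parameters):
`(2(1−v^𝓒)γ^𝓒, (1−v^𝓒)γ^𝓒, (1−e^𝓒)(1−v^𝓒)γ^𝓒, (1−e^Υ)γ^Υ, γ^Υ, 0, 2γ^Υ)`; independent of the `h`-symbols.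
[cite: Hintz2026, (EqExOpLinAB) H l.4772-4783; Hintz2026WavesII, Def 5.18(3) AF l.5626] -/
theorem exA_diag (v e γ eU γU a b c dd ee : R) :
    (fun i => exA v e γ eU γU a b c dd ee i i) =
      ![2 * (1 - v) * γ, (1 - v) * γ, (1 - e) * (1 - v) * γ, (1 - eU) * γU, γU, 0, 2 * γU] := by
  funext i
  fin_cases i <;> simp [exA]

/-- Consistency with `ExteriorNormalOperator.hintzA_diag`: the two diagonals are the same list relabelled by
`toFine`. [cite: Hintz2026, (EqExOpLinAhBh) H l.5005-5016 and (EqExOpLinAB) H l.4772-4783] -/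
theorem exA_diag_relabel (v e γ eU γU a b c dd ee : R) (i : Fin 7) :
    exA v e γ eU γU a b c dd ee i i =
      ExteriorNormalOperator.hintzA v e γ eU γU a b c dd ee (toFine i) (toFine i) := by
  rw [exA_eq_submatrix]; rfl

end Splitting

/-! ## §5  [AF] Def 5.11(5): the outgoing-radial-set threshold, its printed instances, and SRC-A28 -/

/-- Right-hand side of [AF] Def 5.11(5), (5.21) `EqSSOrderAdmOut` (AF l.5418–5419): the order function must
satisfy `s + α_sf < ½(−1 + ϑ_{∂𝒦⁺,out}) + α_𝒦 − η` near `∂ℛ⁺_{∂𝒦⁺,out}` ("with weights `α_sf, α_𝒦` and margin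
`η`", AF l.5397). [cite: Hintz2026WavesII, Def 5.11(5) eq. (5.21), AF l.5411-5419] -/
noncomputable def thrOut (ϑ αK η : ℝ) : ℝ := (-1 + ϑ) / 2 + αK - η

/-- [AF]'s own instance (14.3) `EqA2AdmThr` (AF l.12484–12490): for `□_g` on 1-forms ("`S̲ = 0`", weights
`α_sf, −1`, margin `0`) "this entails the threshold condition `s|_{∂ℛ_out} + α_sf < −3/2`" — with the optimal
`ϑ_out = 2S̲ = 0` of Lemma 5.12. [cite: Hintz2026WavesII, (14.3) AF l.12484-12490 and Lemma 5.12 AF l.5436-5441] -/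
theorem thrOut_af142 : thrOut 0 (-1) 0 = -3 / 2 := by unfold thrOut; norm_num

/-- The spectral-side form [AF] (9.7) `EqSpBThrOut` (AF l.7974: "at `ℛ_out`: `r_σ + α₊ < −½ + S̲`", orders
induced by an order function "with weights `α₊, 0`", AF l.7965) is `thrOut (2S̲) 0 0`.
[cite: Hintz2026WavesII, (9.7) AF l.7965-7975 and Lemma 5.12 AF l.5440] -/
theorem thrOut_spB (S : ℝ) : thrOut (2 * S) 0 0 = -1 / 2 + S := by unfold thrOut; ring

/-- Lemma 5.12's bracket `2S̲ − ε ≤ ϑ_out ≤ 2S̲` at `S̲ = 0` pins `ϑ_out ∈ [−ε, 0]`; Hintz takes `ϑ_out = 0`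
("equal to `min spec S_{E^Υ,E^𝓒} = 0` … by [AF, Lemma 5.12] … no need for an `ε`-loss since `S_{E^Υ,E^𝓒}` is
diagonalizable", H l.9834). [cite: Hintz2026WavesII, Lemma 5.12 AF l.5436-5441; Hintz2026, H l.9834] -/
theorem lemma512_at_zero (ϑ ε : ℝ) (h : 2 * (0 : ℝ) - ε ≤ ϑ ∧ ϑ ≤ 2 * 0) : -ε ≤ ϑ ∧ ϑ ≤ 0 := by
  constructor <;> linarith [h.1, h.2]

/-- **The cited display at Hintz's (EqAdm) parameters.**  (EqAdm) (H l.9817–9820): "Let `s` be a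
stationary-`L_b`-admissible order function with weights `α_sf, −2` and margin `1` (see [AF, Definition 5.11])";
with `ϑ_out = 0` (H l.9834) the right-hand side of [AF] (5.21) is `½(−1+0) + (−2) − 1 = −7/2`.
[cite: Hintz2026, (EqAdm) H l.9817-9820 and H l.9834; Hintz2026WavesII, (5.21) AF l.5418-5419] -/
theorem thrOut_hintzEqAdm : thrOut 0 (-2) 1 = -7 / 2 := by unfold thrOut; norm_num

/-- **DIVERGENCE SRC-A28 (cell `pub-kerr`), the arithmetic.**  Remark `RmkAdmUpper` (H l.9834) reads the same
condition as "so the requirement is that `s + α_sf < −½ − 1` (`1` being the margin)": `−½ − 1 = thrOut 0 0 1`,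
i.e. the `α_𝒦 = −2` summand of the cited display is absent, and `thrOut 0 α_𝒦 1 = −½ − 1` iff `α_𝒦 = 0`.
(Classification — explanatory remark, the theorem `ThmAdm` quantifying over [AF]'s class BY REFERENCE — and load
are recorded in HINTZ-PLAN P29; nothing about either paper's estimates is asserted here.)
[cite: Hintz2026, Remark (RmkAdmUpper) H l.9832-9835; Hintz2026WavesII, (5.21) AF l.5418-5419, (14.3) AF l.12490] -/
theorem srcA28 :
    (-1 / 2 - 1 : ℝ) = thrOut 0 0 1 ∧ thrOut 0 0 1 ≠ thrOut 0 (-2) 1 ∧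
      thrOut 0 0 1 - thrOut 0 (-2) 1 = 2 := by
  unfold thrOut; norm_num

/-- The printed value `−½ − 1` is the cited display's value iff `α_𝒦 = 0`. [cite: Hintz2026, Remark
(RmkAdmUpper) H l.9834; Hintz2026WavesII, (5.21) AF l.5418-5419] -/
theorem thrOut_printed_iff (αK : ℝ) : thrOut 0 αK 1 = -1 / 2 - 1 ↔ αK = 0 := by
  unfold thrOut; constructor <;> intro h <;> linarith

/-- The incoming threshold [AF] Def 5.11(6), (5.22) `EqSSOrderAdmIn` (AF l.5427–5430):
`s + α_sf > ½(−1+ϑ_in) + α_𝒦 + η` — recorded for symmetry: lowering `α_𝒦` from `0` to `−ℵ` RELAXES (6) by `ℵ`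
and TIGHTENS (5) by `ℵ`; raising the margin tightens both. [cite: Hintz2026WavesII, Def 5.11(5)-(6), AF l.5411-5430] -/
noncomputable def thrIn (ϑ αK η : ℝ) : ℝ := (-1 + ϑ) / 2 + αK + η

/-- Passing from weights `(α, 0)`, margin `0` to weights `(α, −ℵ)`, margin `η` lowers the outgoing upper bound
(5.21) by `ℵ + η` and the incoming lower bound (5.22) by `ℵ − η`. [cite: Hintz2026WavesII, Def 5.11(5)-(6), AF
l.5411-5430] -/
theorem thr_monotone (ϑo ϑi αK ℵ η : ℝ) (hℵ : 0 ≤ ℵ) (hη : 0 ≤ η) :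
    thrOut ϑo (αK - ℵ) η ≤ thrOut ϑo αK 0 ∧ thrIn ϑi (αK - ℵ) η ≤ thrIn ϑi αK 0 + η ∧
      thrOut ϑo αK 0 - thrOut ϑo (αK - ℵ) η = ℵ + η ∧ thrIn ϑi αK 0 - thrIn ϑi (αK - ℵ) η = ℵ - η := by
  unfold thrOut thrIn
  refine ⟨by linarith, by linarith, by ring, by ring⟩

/-! ## §6  [AF] Prop 13.18: the "relative order" condition and three printed instances -/

/-- [AF] Prop 13.18 (AF l.12099–12115) maps `H_b^{k+ℓ,(β_scf+1, β_tf+2, β_zf)} → H_b^{k,(β_scf−ε, β_tf, β_zf)}`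
provided `β_tf − β_zf ∈ (β⁻, β⁺)` (the indicial gap) and `β_scf < 1 + S̲`.  In terms of the INPUT's tf- and
zf-orders `(i_tf, i_zf) = (β_tf+2, β_zf)` the gap condition reads `i_tf − i_zf ∈ (β⁻+2, β⁺+2)` — Hintz's
"relative order at tf and zf `∈ (2, 2+ε_ind)`" (H l.12296, l.12549, l.13883) for the gap `(0, ε_ind)`.
[cite: Hintz2026WavesII, Prop 13.18, AF l.12099-12115; Hintz2026, H l.12296, l.12549, l.13883] -/
theorem prop1318_iff (itf izf βlo βhi : ℝ) :
    (βlo < (itf - 2) - izf ∧ (itf - 2) - izf < βhi) ↔ (βlo + 2 < itf - izf ∧ itf - izf < βhi + 2) := by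
  constructor <;> rintro ⟨h1, h2⟩ <;> exact ⟨by linarith, by linarith⟩

/-- The output orders: tf- and zf-orders drop by `(2, 0)` relative to the input, the scf-order by `1 + ε`.
[cite: Hintz2026WavesII, Prop 13.18 eq. (13.x) `EqDResLo`, AF l.12112-12114] -/
theorem prop1318_output (βscf βtf βzf ε : ℝ) :
    (βscf + 1) - (βscf - ε) = 1 + ε ∧ (βtf + 2) - βtf = 2 ∧ βzf - βzf = 0 := by
  refine ⟨by ring, by ring, by ring⟩

/-- Instance H l.11422 (proof of Prop `PropD1Alm`): input `(α̃₊+2−ε, α̃₊+1, α̃_𝒦−1)`, so `β_tf − β_zf =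
(α̃₊+1−2) − (α̃_𝒦−1) = α̃₊ − α̃_𝒦`, which the text assumes `∈ (0, ε_ind)` ("Since `α̃₊ − α̃_𝒦 ∈ (0, ε_ind)` lies
in the indicial gap of `L̂_b(0)`, we can apply [AF, Proposition 13.18]").  Likewise H l.12296:
`(α₊+1) − (α̃_𝒦−1) = (α₊ − α̃_𝒦) + 2`. [cite: Hintz2026, H l.11418-11422 and H l.12296] -/
theorem inst_H11422 (αp αK ε : ℝ) :
    (αp + 1 - 2) - (αK - 1) = αp - αK ∧ (αp + 1) - (αK - 1) = (αp - αK) + 2 ∧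
      ((αp + 2 - ε) - 1 = αp + 1 - ε) := by
  refine ⟨by ring, by ring, by ring⟩

/-- Instance H l.12549 (proof of Prop `PropD4Par`, Step 5): `f̂₅ ∈ H_b^{∞,(2−ε, 2+ε_ind−ε, α_𝒦−2)}` "has relative
tf-order `(2+ε_ind−ε) − (α_𝒦−2) ∈ (2, 2+ε_ind)` (since we can take `ε > 0` arbitrarily small)", under the
proposition's `α_𝒦 ∈ (2, 2+ε_𝒦)`, `ε_𝒦 ∈ (0, ε_ind)` (H l.12381) — true exactly for `0 < ε < ε_ind − ε_𝒦 −
(α_𝒦 − 2)`, in particular for all small `ε`. [cite: Hintz2026, H l.12545-12549 and Prop (PropD4Par) H l.12381] -/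
theorem inst_H12549 (αK εK εInd ε : ℝ) (hK : 2 < αK ∧ αK < 2 + εK) (hεK : 0 < εK ∧ εK < εInd)
    (hε : 0 < ε ∧ ε < εInd - εK) :
    2 < (2 + εInd - ε) - (αK - 2) ∧ (2 + εInd - ε) - (αK - 2) < 2 + εInd := by
  obtain ⟨h1, h2⟩ := hK; obtain ⟨h3, h4⟩ := hεK; obtain ⟨h5, h6⟩ := hε
  constructor <;> linarith

/-- The exact room for `ε` in the previous instance is `(0, 2 + ε_ind − α_𝒦)`, and the `ε`-bound used there,
`ε_ind − ε_𝒦`, lies inside it: `0 < ε_ind − ε_𝒦 < 2 + ε_ind − α_𝒦`. [cite: Hintz2026, H l.12549 and H l.12381] -/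
theorem inst_H12549_room (αK εK εInd : ℝ) (hK : 2 < αK ∧ αK < 2 + εK) (hεK : 0 < εK ∧ εK < εInd) :
    0 < εInd - εK ∧ εInd - εK < 2 + εInd - αK := by
  obtain ⟨h1, h2⟩ := hK; obtain ⟨h3, h4⟩ := hεK; constructor <;> linarith

/-- Instance H l.13883 (proof of Thm `ThmD6`, Step 2.A.8): `f̂₆ ∈ H_b^{∞,(2−ε, 1+ε_ind−ε, α_𝒦−4)}` with
`α_𝒦 − 4 = −1+ε_𝒦−ε` (H l.13879); "the relative order of (EqD6f6) at tf and zf is `2 + ε_ind − ε_𝒦 ∈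
(2, 2+ε_ind)`" — by (EqDMetBasicEllEps) `0 < ε_𝒦 < ε_ind` (H l.10796).
[cite: Hintz2026, (EqD6f6) H l.13878-13883 and (EqDMetBasicEllEps) H l.10796] -/
theorem inst_H13883 (εK εInd ε : ℝ) (hεK : 0 < εK ∧ εK < εInd) :
    (1 + εInd - ε) - (-1 + εK - ε) = 2 + εInd - εK ∧
      (2 < 2 + εInd - εK ∧ 2 + εInd - εK < 2 + εInd) := by
  obtain ⟨h1, h2⟩ := hεK
  refine ⟨by ring, by linarith, by linarith⟩

/-- (EqDMetBasicEllEps) (H l.10796): `0 < ε_𝒦 < ε₊ < min(ε_ind, ε_𝒥) < 1` gives the two facts used above and in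
§3: `ε_𝒦 < ε_ind` and `0 < ε_𝒦`. [cite: Hintz2026, (EqDMetBasicEllEps) H l.10796] -/
theorem ellEps_consequences (εK εp εInd εScri : ℝ)
    (h : 0 < εK ∧ εK < εp ∧ εp < min εInd εScri ∧ min εInd εScri < 1) :
    0 < εK ∧ εK < εInd ∧ εK < εScri ∧ εp < 1 := by
  obtain ⟨h1, h2, h3, h4⟩ := h
  have ha : min εInd εScri ≤ εInd := min_le_left _ _
  have hb : min εInd εScri ≤ εScri := min_le_right _ _
  exact ⟨h1, by linarith, by linarith, by linarith⟩

/-! ## §7  Lemma `LemmaAdmPfInt` ↔ [AF] Lemma 14.6: the exponent bookkeeping of the displayed proof (SRC-A31) -/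

/-- The Cauchy–Schwarz split in both proofs: `|∫ s^{ℓ−1} f₀ ds|² ≤ (∫ s^{2α} ds)(∫ s^{2(ℓ−1−α)}|f₀|² ds)`, i.e. the two
squared weights add up to `2(ℓ−1)` — [AF] prints `s^{2α}` and `s^{2ℓ−2−2α}` (AF l.12606–12607); Hintz prints `s^{2α}`
and "`s^{2ℓ−2α−1}`" (H l.10657–10658), whose sum is `2(ℓ−1) + 1`. [cite: Hintz2026WavesII, proof of Lemma 14.6, AF
l.12604-12610; Hintz2026, proof of Lemma (LemmaAdmPfInt) H l.10655-10659] -/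
theorem lemma146_cs_exponent (ℓ α : ℝ) :
    2 * α + (2 * ℓ - 2 - 2 * α) = 2 * (ℓ - 1) ∧ 2 * α + (2 * ℓ - 2 * α - 1) = 2 * (ℓ - 1) + 1 := by
  constructor <;> ring

/-- "Fix any `α ∈ (−½, ℓ−1)`" (AF l.12604 = H l.10656): the window is inhabited iff `ℓ > ½`, the lemma's hypothesis
(AF l.12597 "`ℓ > ½`" = H l.10643). [cite: Hintz2026WavesII, Lemma 14.6, AF l.12597 and l.12604; Hintz2026, Lemma
(LemmaAdmPfInt) H l.10643 and l.10656] -/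
theorem lemma146_window (ℓ : ℝ) : (∃ α : ℝ, -1 / 2 < α ∧ α < ℓ - 1) ↔ 1 / 2 < ℓ := by
  constructor
  · rintro ⟨α, h1, h2⟩; linarith
  · intro h; exact ⟨(-1 / 2 + (ℓ - 1)) / 2, by linarith, by linarith⟩

/-- The two integrability conditions behind the window: `∫_s^∞ t^{−2ℓ+2α+1} dt < ∞` iff the exponent is `< −1` iff
`α < ℓ − 1`; `∫_{r/2}^t s^{2α} ds ≲ t^{2α+1}` with a positive power iff `α > −½`.
[cite: Hintz2026WavesII, proof of Lemma 14.6, AF l.12604-12610; Hintz2026, H l.10656-10659] -/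
theorem lemma146_integrability (ℓ α : ℝ) :
    (-2 * ℓ + 2 * α + 1 < -1 ↔ α < ℓ - 1) ∧ (0 < 2 * α + 1 ↔ -1 / 2 < α) := by
  constructor <;> constructor <;> intro h <;> linarith

/-- **DIVERGENCE SRC-A31 (cell `pub-kerr`), the arithmetic.**  After Fubini the `s`-weight of `|f₀(s,r)|²` is the
Cauchy–Schwarz weight times `∫_s^∞ t^{−2ℓ+2α+1} dt ≂ s^{−2ℓ+2α+2}`: with [AF]'s `2ℓ−2−2α` the total power is `0` (so the
chain ends in `≲ ‖f₀‖²_{L²}`, as both texts conclude, AF l.12610 / H l.10659), with the printed "`2ℓ−2α−1`" of H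
l.10657–10658 it would be `1`.  A one-symbol transcription slip in an intermediate line; nothing else changes.
[cite: Hintz2026, proof of Lemma (LemmaAdmPfInt) H l.10655-10659; Hintz2026WavesII, AF l.12604-12610] -/
theorem srcA31 (ℓ α : ℝ) :
    (2 * ℓ - 2 - 2 * α) + (-2 * ℓ + 2 * α + 2) = 0 ∧ (2 * ℓ - 2 * α - 1) + (-2 * ℓ + 2 * α + 2) = 1 := by
  constructor <;> ring

end Hintz2026.ForwardSolutionDictionary

end Literature.Geometry.Lorentzian
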